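import Summits.ResolutionOfSingularities.ResolutionOfSingularities.Theorems.MarkedTransferCampaignW46CuspStaircaseLength
import Summits.ResolutionOfSingularities.ResolutionOfSingularities.Theorems.MarkedTransferCampaignW46CuspIndexIntrinsic
import HarnessLib

/-!
# [OURS · L1 W4.6, rung (iii)] The cusp staircase, XV — EXACT RESOLUTION LENGTH: every complete §2.1-permissible
# point-blow-up sequence from a staircase state has the SAME length `ℓ(E₀) = Σ_ξ ⌊index(ξ)/b⌋`, and one exists
# (cell res-hironaka, LADDER-RESOLUTION rung L, D-0089; slot W4.6, seat res-L1-s46-pv-5 gen 3; host route MarkedTransfer,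
# `--kind proof --supports stmt-ResolutionOfSingularities-16155 --as helper`)

HONEST FRAMING. Everything below is OURS: kernel theorems about the campaign objects of this seat's files I–XIV and pv-1's
résumé-free `FinPermissibleRun`, using pv-13's intrinsic cusp index (`Cusp.cuspIndex_eq`, `…CuspIndexIntrinsic.lean`
p502069). NOTHING here is a statement of H. Hironaka's manuscript *Resolution of singularities in positive characteristics*
(2017-03-23, [Hironaka2017]) and nothing here asserts that any statement of it holds. No FACT-LIST premise is used. AI
review is weaker than expert review. No `sorry`; axioms standard; def-free.

## What is proved (`ℓ(E) := ((cuspMultiset E).map (· / E.b)).sum = Σ_{ξ ∈ Sing(E)} ⌊index(ξ)/b⌋`)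

* `Cusp.exists_mem_sing_transform_of_ne` — off the centre every singular point of `E` lifts to a singular point of `E′`.
* `Cusp.transform_stepCount_add_one_eq` — **the step count drops by EXACTLY one** at every §2.1-permissible blow-up of a
  staircase state (file XIV gave `≤`; `≥` uses the intrinsic index: the singular point over a centre of index `d > 2b` has
  index exactly `d − b`, and there is one, `MohWindow.exists_le_idealOrder_controlledTransform_of_le`).
* `stepCount_eq_zero_iff` — for a staircase state, `ℓ(E) = 0 ↔ Sing(E) = ∅`.
* `FinPermissibleRun.stepCount_add_eq` — along a finite permissible sequence from a staircase state, `ℓ(E_k) + k = ℓ(E₀)`;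
  **`FinPermissibleRun.sing_eq_empty_iff_len_eq`** — the sequence ends at a RESOLVED state (`Sing(E_len) = ∅`) iff
  `len = ℓ(E₀)`: the resolution length does not depend on the order in which the singular points are blown up.
* **`Cusp.exists_finPermissibleRun_resolved`** — over a PERFECT field, from every standard staircase state there IS a finite
  §2.1-permissible sequence of length `ℓ(E₀)` ending at a resolved state (blow up any closed singular point while one exists;
  `Cusp.exists_pointBlowup`, file XIII).

## References

* This seat, files VI, X–XIV; pv-13 `…CuspIndexIntrinsic.lean`; pv-1 `…FiniteExitBound.lean`, `…LiteralCentreProcrastination.lean`.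
* H. Hironaka, ms. 2017-03-23, §2.1 p.4 l.35–39, Th. 16.13 p.87 l.26–28 — scope only, under adjudication, not cited as
  fact. [Hironaka2017]
-/

noncomputable section

set_option linter.dupNamespace false -- mandated namespace of this single-conjunct summit

open CategoryTheory AlgebraicGeometry TopologicalSpace IsLocalRing

namespace Summit.ResolutionOfSingularities.ResolutionOfSingularities.Theorems

namespace CampaignW46

open Literature.AlgebraicGeometry.Resolution
open Literature.AlgebraicGeometry.Hironaka2017.S02Preliminaries
open Literature.AlgebraicGeometry.Hironaka2017.Datum
open Scheme.IdealSheafData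

universe u

variable {p : ℕ} [Fact p.Prime] {K : Type u} [Field K] [CharP K p]

namespace Cusp

variable {A A' : AmbientDatum p K} {E : IdealExponent A.Z} {D : Closeds A.Z} {π : A'.Z ⟶ A.Z}

/-- **Off the centre, singular points lift**: for the blow-up `π` along (the reduced ideal of) `D` and `z ∈ Sing(E)` off `D`,
there is `x′ ∈ Sing(E′)` with `π x′ = z` (`π` is an isomorphism over the complement of `D`, tree `IsBlowup.isIso_compl`;
singularity is unchanged there, pv-1's `mem_sing_transform_iff_of_not_mem`). [cite: StacksProject, Tag 02OS] -/
theorem exists_mem_sing_transform_of_ne (hπ : IsBlowup π (vanishingIdeal D)) {z : A.Z} (hzS : z ∈ E.sing)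
    (hzD : z ∉ (D : Set A.Z)) : ∃ x' ∈ (E.transform π D).sing, π.base x' = z := by
  haveI : IsLocallyNoetherian A'.Z := by
    haveI := A'.smooth
    exact LocallyOfFiniteType.isLocallyNoetherian A'.hom
  have hzD' : z ∉ (vanishingIdeal D).support := by
    rw [← SetLike.mem_coe, Scheme.IdealSheafData.coe_support_vanishingIdeal]
    exact hzD
  set W₀ : A.Z.Opens := ⟨((vanishingIdeal D).support : Set A.Z)ᶜ, (vanishingIdeal D).support.isClosed.isOpen_compl⟩
  haveI : IsIso (π ∣_ W₀) := hπ.isIso_compl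
  obtain ⟨y', hy'⟩ := (ConcreteCategory.bijective_of_isIso ((π ∣_ W₀).base)).2 ⟨z, hzD'⟩
  have hπy : π.base y'.1 = z := by
    have := congrArg Subtype.val hy'
    rwa [morphismRestrict_base_coe] at this
  refine ⟨y'.1, ?_, hπy⟩
  have hnot : π y'.1 ∉ (D : Set A.Z) := by
    show π.base y'.1 ∉ (D : Set A.Z)
    rw [hπy]; exact hzD
  exact (mem_sing_transform_iff_of_not_mem hπ E hnot).2 (hπy ▸ hzS)

/-- [OURS · L1 W4.6 rung (iii); NOT a statement of the manuscript] **The step count drops by EXACTLY one at every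
§2.1-permissible blow-up of a staircase state**: `ℓ(E′) + 1 = ℓ(E)`. `≤` is file XIV; for `≥`: off the centre `ξ` every
singular point lifts with the same index; over `ξ` (index `d`, `b ∤ d`): if `d < 2b` nothing is singular and `⌊d/b⌋ = 1`;
if `d > 2b` the chart origin is singular (`MohWindow.exists_le_idealOrder_controlledTransform_of_le`) with a presentation of
exponent `d − b`, hence index EXACTLY `d − b` (pv-13 `Cusp.cuspIndex_eq`), and `⌊(d − b)/b⌋ + 1 = ⌊d/b⌋`. [folklore] -/
theorem transform_stepCount_add_one_eq (hπ : IsBlowup π (vanishingIdeal D)) (hRg : Regime.cuspCurve A E)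
    (hDirr : IsIrreducible (D : Set A.Z)) (hDS : (D : Set A.Z) ⊆ E.sing) :
    ((cuspMultiset (E.transform π D)).map (· / E.b)).sum + 1 = ((cuspMultiset E).map (· / E.b)).sum := by
  classical
  refine le_antisymm (transform_stepCount_add_one_le hπ hRg hDirr hDS) ?_
  obtain ⟨ξ, hξS, hξcl, hDξ⟩ := exists_eq_singleton_of_subset_sing hRg.2.2.1 hDirr hDS
  have hb : 0 < E.b := hRg.1
  have hfin : E.sing.Finite := hRg.2.1
  have hfin' : (E.transform π D).sing.Finite := (transform_sing_finite_and_ncard_le hπ hRg hDirr hDS).1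
  haveI : IsLocallyNoetherian A'.Z := by
    haveI := A'.smooth
    exact LocallyOfFiniteType.isLocallyNoetherian A'.hom
  obtain ⟨S, hS⟩ : ∃ S : Finset A.Z, S = hfin.toFinset := ⟨_, rfl⟩
  obtain ⟨S', hS'⟩ : ∃ S' : Finset A'.Z, S' = hfin'.toFinset := ⟨_, rfl⟩
  have hmemS : ∀ z, z ∈ S ↔ z ∈ E.sing := fun z => by rw [hS, Set.Finite.mem_toFinset]
  have hmemS' : ∀ z, z ∈ S' ↔ z ∈ (E.transform π D).sing := fun z => by rw [hS', Set.Finite.mem_toFinset]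
  set Soff := S'.filter (fun x' => π.base x' ≠ ξ) with hSoff
  set Sfib := S'.filter (fun x' => ¬ π.base x' ≠ ξ) with hSfib
  set T := Soff.image π.base with hT
  set f : A.Z → ℕ := fun z => cuspIndexAt E z / E.b with hf
  set f' : A'.Z → ℕ := fun z => cuspIndexAt (E.transform π D) z / E.b with hf'
  have hoff : ∀ x' ∈ Soff, π.base x' ∈ E.sing ∧
      cuspIndexAt (E.transform π D) x' = cuspIndexAt E (π.base x') :=
    fun x' hx' => transform_mem_sing_and_cuspIndexAt_eq_of_ne hπ hDξ ((hmemS' x').mp (Finset.mem_filter.mp hx').1)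
      (Finset.mem_filter.mp hx').2
  have hinj : ∀ x₁ ∈ Soff, ∀ x₂ ∈ Soff, π.base x₁ = π.base x₂ → x₁ = x₂ := by
    intro x₁ hx₁ x₂ hx₂ h
    refine MohWindow.injOn_preimage_compl hπ ?_ ?_ h
    · show π.base x₁ ∈ (D : Set A.Z)ᶜ
      rw [hDξ]; exact (Finset.mem_filter.mp hx₁).2
    · show π.base x₂ ∈ (D : Set A.Z)ᶜ
      rw [hDξ]; exact (Finset.mem_filter.mp hx₂).2
  -- off the centre `π` is ONTO `Sing(E) ∖ {ξ}`
  have hST : S.erase ξ ⊆ T := by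
    intro z hz
    obtain ⟨hzξ, hzS⟩ := Finset.mem_erase.mp hz
    have hzD : z ∉ (D : Set A.Z) := by rw [hDξ]; exact hzξ
    obtain ⟨x', hx'S, hπx⟩ := exists_mem_sing_transform_of_ne hπ ((hmemS z).mp hzS) hzD
    refine Finset.mem_image.mpr ⟨x', Finset.mem_filter.mpr ⟨(hmemS' x').mpr hx'S, ?_⟩, hπx⟩
    rw [hπx]; exact hzξ
  have hξmem : ξ ∈ S := (hmemS ξ).mpr hξS
  obtain ⟨hnd, hshape⟩ := Cusp.cuspIndex_spec (hRg.2.2.2 ξ hξS)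
  have hbd : E.b < cuspIndexAt E ξ := Cusp.lt_of_cuspShape_of_le_pow hshape hnd (stalkIdeal_le_pow_of_mem_sing hξS)
  have hM' : ((cuspMultiset (E.transform π D)).map (· / E.b)).sum = ∑ x' ∈ Soff, f' x' + ∑ x' ∈ Sfib, f' x' := by
    rw [stepCount_eq_sum _ hfin', ← hS', hSoff, hSfib, Finset.sum_filter_add_sum_filter_not]
  have hM : ((cuspMultiset E).map (· / E.b)).sum = ∑ z ∈ S.erase ξ, f z + f ξ := by
    rw [stepCount_eq_sum _ hfin, ← hS, Finset.sum_erase_add S _ hξmem]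
  have hX : ∑ x' ∈ Soff, f' x' = ∑ z ∈ T, f z := by
    rw [hT, Finset.sum_image hinj]
    refine Finset.sum_congr rfl fun x' hx' => ?_
    simp only [hf, hf', (hoff x' hx').2]
  have hXge : ∑ z ∈ S.erase ξ, f z ≤ ∑ z ∈ T, f z := Finset.sum_le_sum_of_subset hST
  -- the fibre: `⌊d/b⌋ ≤ Σ_{fibre} + 1`
  have hfib : f ξ ≤ ∑ x' ∈ Sfib, f' x' + 1 := by
    by_cases h2 : 2 * E.b ≤ cuspIndexAt E ξ
    · -- the chart origin is singular, of index exactly `d − b`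
      have h2' : 2 * E.b < cuspIndexAt E ξ := by
        rcases h2.lt_or_eq with h | h
        · exact h
        · exact absurd (Dvd.intro_left 2 h) hnd
      obtain ⟨hreg, hdim, x, y, hxy, u, hu, hJ⟩ := hshape
      haveI := hreg
      obtain ⟨c, hc_def⟩ : ∃ c : Fin 2 → A.Z.presheaf.stalk ξ, c = ![x, y] := ⟨_, rfl⟩
      have hc0 : c 0 = x := by rw [hc_def]; rfl
      have hc1 : c 1 = y := by rw [hc_def]; rfl
      have hc : Ideal.span (Set.range c) = maximalIdeal _ := by rw [hc_def, MohWindow.range_vec2]; exact hxy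
      have hY : stalkIdeal (vanishingIdeal D) ξ = maximalIdeal (A.Z.presheaf.stalk ξ) := by
        apply stalkIdeal_vanishingIdeal_eq_maximalIdeal_of_closure_eq
        rw [hDξ, hξcl.closure_eq]
      have hJc : stalkIdeal E.J ξ = Ideal.span {c 1 ^ E.b + u * c 0 ^ cuspIndexAt E ξ} := by
        rw [hJ, hc0, hc1]; rfl
      obtain ⟨x', hπx, hle⟩ :=
        MohWindow.exists_le_idealOrder_controlledTransform_of_le hπ hb h2 hdim c hc hY hJc
      have hx'S : x' ∈ (E.transform π D).sing := hle
      have hπx' : π.base x' = ξ := hπx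
      have hidx := (transform_cuspAt_and_cuspIndexAt_le_of_over hπ hRg hξS hDξ hx'S hπx').2
      -- index of `x′` is exactly `d − b`
      have hshape0 : CuspShape E.b (cuspIndexAt E ξ) (A.Z.presheaf.stalk (π x')) (stalkIdeal E.J (π x')) := by
        rw [hπx]; exact ⟨hreg, hdim, x, y, hxy, u, hu, hJ⟩
      have hY' : stalkIdeal (vanishingIdeal D) (π x') = maximalIdeal (A.Z.presheaf.stalk (π x')) := by
        rw [hπx]; exact hY
      have hshape' := Cusp.cuspShape_transform_of_le hπ hb hbd hY' hshape0 hle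
      have hnd' : ¬ E.b ∣ (cuspIndexAt E ξ - E.b) := fun h => hnd (by
        have h3 := dvd_add h (dvd_refl E.b)
        rwa [Nat.sub_add_cancel hbd.le] at h3)
      have heq : cuspIndexAt (E.transform π D) x' = cuspIndexAt E ξ - E.b :=
        Cusp.cuspIndex_eq hshape' hnd' hb (by change E.b < cuspIndexAt E ξ - E.b; omega)
      have hx'fib : x' ∈ Sfib := Finset.mem_filter.mpr ⟨(hmemS' x').mpr hx'S, not_not.mpr hπx'⟩
      have hsingle : f' x' ≤ ∑ z ∈ Sfib, f' z := Finset.single_le_sum (fun _ _ => Nat.zero_le _) hx'fib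
      have hfx : f' x' + 1 = f ξ := by
        show cuspIndexAt (E.transform π D) x' / E.b + 1 = cuspIndexAt E ξ / E.b
        rw [heq, ← Nat.add_div_right _ hb, Nat.sub_add_cancel hbd.le]
      omega
    · -- the window case: nothing singular is needed, `⌊d/b⌋ = 1`
      have h1 : f ξ = 1 := by
        show cuspIndexAt E ξ / E.b = 1
        apply le_antisymm
        · exact Nat.lt_succ_iff.mp ((Nat.div_lt_iff_lt_mul hb).mpr (by omega))
        · exact (Nat.le_div_iff_mul_le hb).mpr (by omega)
      omega
  rw [hM', hM, hX]
  omega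

end Cusp

/-- [OURS · L1 W4.6 rung (iii); NOT a statement of the manuscript] For a staircase state, **`ℓ(E) = 0` iff `E` is resolved**
(`Sing(E) = ∅`): every singular point contributes `⌊index/b⌋ ≥ 1`. [folklore] -/
theorem stepCount_eq_zero_iff {A : AmbientDatum p K} {E : IdealExponent A.Z}
    (hRg : Regime.cuspCurve (p := p) (K := K) A E) :
    ((cuspMultiset E).map (· / E.b)).sum = 0 ↔ E.sing = ∅ := by
  classical
  obtain ⟨hb, hfin, -, hcusp⟩ := hRg
  rw [stepCount_eq_sum _ hfin, Finset.sum_eq_zero_iff]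
  constructor
  · intro h
    apply Set.eq_empty_of_forall_notMem
    intro ξ hξ
    have h0 := h ξ ((Set.Finite.mem_toFinset hfin).mpr hξ)
    obtain ⟨hnd, hshape⟩ := Cusp.cuspIndex_spec (hcusp ξ hξ)
    have hgt : E.b < cuspIndexAt E ξ :=
      Cusp.lt_of_cuspShape_of_le_pow hshape hnd (stalkIdeal_le_pow_of_mem_sing hξ)
    have h1 : 1 ≤ cuspIndexAt E ξ / E.b := (Nat.le_div_iff_mul_le hb).mpr (by omega)
    omega
  · intro h ξ hξ
    rw [Set.Finite.mem_toFinset, h] at hξ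
    exact absurd hξ (Set.notMem_empty _)

namespace FinPermissibleRun

variable (r : FinPermissibleRun p K)

/-- [OURS · L1 W4.6 rung (iii); NOT a statement of the manuscript] Along a finite §2.1-permissible sequence from a staircase
state: `ℓ(E_k) + k = ℓ(E₀)` for every `k ≤ len` (`Cusp.transform_stepCount_add_one_eq` at every step). [folklore] -/
theorem stepCount_add_eq (h0 : Regime.cuspCurve (p := p) (K := K) (r.A 0) (r.E 0)) :
    ∀ k, k ≤ r.len →
      ((cuspMultiset (r.E k)).map (· / (r.E 0).b)).sum + k = ((cuspMultiset (r.E 0)).map (· / (r.E 0).b)).sum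
  | 0, _ => by simp
  | k + 1, hk => by
    have hk' : k < r.len := hk
    have hstep := Cusp.transform_stepCount_add_one_eq (r.blowup k hk') (r.cuspCurve_of_zero h0 k hk'.le)
      (r.permissible k hk').irreducible (r.permissible k hk').subset_sing
    rw [← r.E_succ k hk', r.b_eq_of_le k hk'.le] at hstep
    have ih := stepCount_add_eq h0 k hk'.le
    omega

/-- [OURS · L1 W4.6 rung (iii); NOT a statement of the manuscript] **THE RESOLUTION LENGTH IS AN INVARIANT**: a finite
§2.1-permissible blow-up sequence from a staircase state `(A₀, E₀)` ends at a RESOLVED state (`Sing(E_len) = ∅`) if and only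
if its length is `ℓ(E₀) = Σ_{ξ ∈ Sing(E₀)} ⌊index(ξ)/b⌋` — whatever the order in which the singular points were blown up
(`stepCount_add_eq` + `stepCount_eq_zero_iff` at the last stage, itself a staircase state). [folklore] -/
theorem sing_eq_empty_iff_len_eq (h0 : Regime.cuspCurve (p := p) (K := K) (r.A 0) (r.E 0)) :
    (r.E r.len).sing = ∅ ↔ r.len = ((cuspMultiset (r.E 0)).map (· / (r.E 0).b)).sum := by
  have h := r.stepCount_add_eq h0 r.len le_rfl
  have hz := stepCount_eq_zero_iff (r.cuspCurve_of_zero h0 r.len le_rfl)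
  rw [r.b_eq_of_le r.len le_rfl] at hz
  rw [← hz]
  omega

end FinPermissibleRun

namespace Cusp

/-- [OURS · L1 W4.6 rung (iii); NOT a statement of the manuscript] **A complete resolution sequence EXISTS** over a PERFECT
field: from every standard staircase state `(A₀, E₀)` there is a finite §2.1-permissible blow-up sequence of length `ℓ(E₀)`,
which therefore ends at a resolved state (`FinPermissibleRun.sing_eq_empty_iff_len_eq`) — blow up any closed singular point
while one exists (`exists_pointBlowup`, file XIII; the successor is again a standard staircase state, `transform_cuspCurve`;
the step count falls by exactly one, so singular points remain for `ℓ(E₀)` steps). [folklore] -/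
theorem exists_finPermissibleRun_resolved [PerfectField K] (A₀ : AmbientDatum p K) (E₀ : IdealExponent A₀.Z)
    (hE₀ : E₀.IsStandard) (hRg₀ : Regime.cuspCurve (p := p) (K := K) A₀ E₀) :
    ∃ r : FinPermissibleRun p K, (⟨r.A 0, r.E 0⟩ : Σ A : AmbientDatum p K, IdealExponent A.Z) = ⟨A₀, E₀⟩ ∧
      r.len = ((cuspMultiset E₀).map (· / E₀.b)).sum ∧ (r.E r.len).sing = ∅ := by
  classical
  -- one step, projection-free: blow up a closed singular point while one exists, pad otherwise
  have hnext : ∀ (A : AmbientDatum p K) (E : IdealExponent A.Z), E.IsStandard →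
      Regime.cuspCurve (p := p) (K := K) A E →
      ∃ (A' : AmbientDatum p K) (π : A'.Z ⟶ A.Z) (E' : IdealExponent A'.Z) (D : Closeds A.Z),
        E'.IsStandard ∧ Regime.cuspCurve (p := p) (K := K) A' E' ∧
        (E.sing.Nonempty → A'.hom = π ≫ A.hom ∧ IsBlowup π (vanishingIdeal D) ∧ E.IsPermissibleCentre A.hom D ∧
          E' = E.transform π D) := by
    intro A E hE hRg
    by_cases hne : E.sing.Nonempty
    · obtain ⟨ξ, hξS⟩ := hne
      have hξcl : IsClosed ({ξ} : Set A.Z) := hRg.2.2.1 hξS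
      obtain ⟨hnd, hshape⟩ := Cusp.cuspIndex_spec (hRg.2.2.2 ξ hξS)
      obtain ⟨A', π, hhom, hπ, hperm, hstd⟩ :=
        exists_pointBlowup A E hE hξcl hξS (singleton_ne_univ_of_cuspShape A hshape)
      refine ⟨A', π, E.transform π ⟨{ξ}, hξcl⟩, ⟨{ξ}, hξcl⟩, hstd, ?_, fun _ => ⟨hhom, hπ, hperm, rfl⟩⟩
      exact transform_cuspCurve hπ hhom hRg isIrreducible_singleton (Set.singleton_subset_iff.2 hξS)
    · exact ⟨A, 𝟙 _, E, ⊥, hE, hRg, fun h => absurd h hne⟩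
  choose fA fπ fE fD hstd' hRg' hstep using hnext
  -- the recursion
  let T : Type (u + 1) := Σ' (A : AmbientDatum p K) (E : IdealExponent A.Z),
    E.IsStandard ∧ Regime.cuspCurve (p := p) (K := K) A E
  let S₀ : T := ⟨A₀, E₀, hE₀, hRg₀⟩
  let nxt : T → T := fun S =>
    ⟨fA S.1 S.2.1 S.2.2.1 S.2.2.2, fE S.1 S.2.1 S.2.2.1 S.2.2.2, hstd' S.1 S.2.1 S.2.2.1 S.2.2.2,
      hRg' S.1 S.2.1 S.2.2.1 S.2.2.2⟩
  let seq : ℕ → T := fun k => Nat.rec S₀ (fun _ S => nxt S) k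
  have hseqS : ∀ k, seq (k + 1) = nxt (seq k) := fun k => rfl
  set N := ((cuspMultiset E₀).map (· / E₀.b)).sum with hN
  -- the step count along the recursion: `ℓ(E_k) + k = N` and `b` constant, for `k ≤ N`
  have hcount : ∀ k, k ≤ N →
      (seq k).2.1.b = E₀.b ∧ ((cuspMultiset (seq k).2.1).map (· / E₀.b)).sum + k = N := by
    intro k
    induction k with
    | zero =>
      intro _
      refine ⟨rfl, ?_⟩
      rw [Nat.add_zero, hN]
      rfl
    | succ k ih =>
      intro hk
      obtain ⟨hbk, hℓk⟩ := ih (Nat.le_of_succ_le hk)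
      have hpos : ((cuspMultiset (seq k).2.1).map (· / (seq k).2.1.b)).sum ≠ 0 := by
        rw [hbk]; omega
      have hne : (seq k).2.1.sing.Nonempty := by
        rw [Set.nonempty_iff_ne_empty]
        exact fun h => hpos ((stepCount_eq_zero_iff (seq k).2.2.2).mpr h)
      obtain ⟨hhom, hπ, hperm, hE'⟩ := hstep (seq k).1 (seq k).2.1 (seq k).2.2.1 (seq k).2.2.2 hne
      have hE'' : (seq (k + 1)).2.1 = (seq k).2.1.transform (fπ (seq k).1 (seq k).2.1 (seq k).2.2.1 (seq k).2.2.2)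
          (fD (seq k).1 (seq k).2.1 (seq k).2.2.1 (seq k).2.2.2) := hE'
      have hdrop := Cusp.transform_stepCount_add_one_eq hπ (seq k).2.2.2 hperm.irreducible hperm.subset_sing
      refine ⟨?_, ?_⟩
      · rw [congrArg IdealExponent.b hE'', ← hbk]
        rfl
      · rw [hE'']
        rw [hbk] at hdrop
        omega
  -- genuine steps below `N`
  have hne : ∀ k, k < N → (seq k).2.1.sing.Nonempty := by
    intro k hk
    obtain ⟨hbk, hℓk⟩ := hcount k hk.le
    have hpos : ((cuspMultiset (seq k).2.1).map (· / (seq k).2.1.b)).sum ≠ 0 := by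
      rw [hbk]; omega
    rw [Set.nonempty_iff_ne_empty]
    exact fun h => hpos ((stepCount_eq_zero_iff (seq k).2.2.2).mpr h)
  refine ⟨⟨N, fun k => (seq k).1, fun k => (seq k).2.1,
    fun k => fD (seq k).1 (seq k).2.1 (seq k).2.2.1 (seq k).2.2.2,
    fun k => fπ (seq k).1 (seq k).2.1 (seq k).2.2.1 (seq k).2.2.2,
    fun k _ => (seq k).2.2.1,
    fun k hk => (hstep (seq k).1 (seq k).2.1 (seq k).2.2.1 (seq k).2.2.2 (hne k hk)).2.2.1,
    fun k hk => (hstep (seq k).1 (seq k).2.1 (seq k).2.2.1 (seq k).2.2.2 (hne k hk)).1,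
    fun k hk => (hstep (seq k).1 (seq k).2.1 (seq k).2.2.1 (seq k).2.2.2 (hne k hk)).2.1,
    fun k hk => (hstep (seq k).1 (seq k).2.1 (seq k).2.2.1 (seq k).2.2.2 (hne k hk)).2.2.2⟩, rfl, rfl, ?_⟩
  -- the last stage is resolved
  obtain ⟨hbN, hℓN⟩ := hcount N le_rfl
  have h0 : ((cuspMultiset (seq N).2.1).map (· / (seq N).2.1.b)).sum = 0 := by rw [hbN]; omega
  exact (stepCount_eq_zero_iff (seq N).2.2.2).mp h0

end Cusp

end CampaignW46

end Summit.ResolutionOfSingularities.ResolutionOfSingularities.Theorems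

end
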